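import Summits.AtomisticToContinuum.HydrodynamicLimit.Theorems.BoxDissipativeWeakStrongLocalGibbsFineScaleStaticsMain
import Summits.AtomisticToContinuum.HydrodynamicLimit.Theorems.OneFlightGossipEngineUniformLocalGibbsConcentration
import Summits.AtomisticToContinuum.HydrodynamicLimit.Theses.BoxDissipativeWeakStrong

/-!
# `LocalGibbsFineScale` (route `BoxDissipativeWeakStrong`): the fine-scale initial law of large
numbers, for positive existence times

Item stmt-AtomisticToContinuum-9905 (`LocalGibbsFineScale`, K0 of card dissipative-box-closure-bf18):
for continuous profiles `a₀, θ₀ > 0`, `u₀`, reduced densities `σ < σ₀(a₀)`, every classical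
hard-sphere-Euler solution `(ρ, u, θ)` on `[0, T)` whose `t = 0` fields are the macroscopic LLN limit
of the local Gibbs laws, every flow family and every kinetic window `ℓ_N` (`0 < ℓ_N ≤ 1`, `ℓ_N → 0`,
`(N+1)ℓ_N³ → ∞`), the box fields at `t = 0` converge in `L¹(P_N ⊗ dx)`:
`E_P ∫ (|ρ̂ - ρ(0,·)| + ‖m̂ - ρu(0,·)‖ + |Ê - E(0,·)|) dx → 0`.

`localGibbsFineScale_of_pos` proves this **for `0 < T`** (the statement of the route decl with the
single hypothesis `0 < T` inserted after `IsHardSphereEulerSolution σ T ρ u θ`). For `T ≤ 0` the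
predicate `IsHardSphereEulerSolution σ T ρ u θ` is vacuous (`Ico 0 T = ∅`), so `ρ 0, u 0, θ 0` are
arbitrary — possibly non-measurable — functions, constrained only through Bochner integrals with
junk value `0`; that corner is reported to the planner as a misstatement (see the item notes) and
is not the mathematics of K0. Everything else is literal: `σ₀ = min (1/4) (1/(64 e M v₁))`
(`M = sup a₀ / ∫ a₀`), the limit profile is the tree's `ρ₀ = rhoLim (profileOf a₀) σ`, the
identification `(ρ, ρu, E)(0, ·) = (ρ₀, ρ₀u₀, E(ρ₀,u₀,θ₀))` follows from the hypothesis at `t = 0`,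
the macroscopic exponential LLN `UniformLGC` (route `OneFlightGossipEngine`), uniqueness of limits
in probability and continuity of the time-`0` slices (`0 < T`), and the statics is
`LGFS.statics_kernel` (files 1–9) at the route's box kernel.
-/

noncomputable section

namespace Summit.AtomisticToContinuum.HydrodynamicLimit.Theorems
namespace LGFS
open MeasureTheory ProbabilityTheory Finset Filter Topology Metric
open Literature.Probability.LatticeModels Literature.MathematicalPhysics.StatisticalMechanics
  Literature.MathematicalPhysics.KineticTheory
open Literature.Analysis.FluidPDE (Config HardSphereFlow)
open Set Function
open scoped ENNReal

/-! ### Uniqueness of limits in probability -/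

/-- **Limits in probability are unique**: if `X_N → a` and `X_N → b` in probability along
probability measures `P_N`, then `a = b`. -/
theorem eq_of_tendsto_measure_lt_norm_sub {Ω : ℕ → Type*} [∀ N, MeasurableSpace (Ω N)]
    {E : Type*} [NormedAddCommGroup E] (P : ∀ N, Measure (Ω N)) [∀ N, IsProbabilityMeasure (P N)]
    (X : ∀ N, Ω N → E) {a b : E}
    (ha : ∀ δ : ℝ, 0 < δ → Tendsto (fun N => P N {ω | δ < ‖X N ω - a‖}) atTop (𝓝 0))
    (hb : ∀ δ : ℝ, 0 < δ → Tendsto (fun N => P N {ω | δ < ‖X N ω - b‖}) atTop (𝓝 0)) : a = b := by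
  by_contra hab
  have hd : 0 < ‖a - b‖ / 3 := div_pos (norm_pos_iff.2 (sub_ne_zero.2 hab)) (by norm_num)
  have hcover : ∀ N, (Set.univ : Set (Ω N)) ⊆
      {ω | ‖a - b‖ / 3 < ‖X N ω - a‖} ∪ {ω | ‖a - b‖ / 3 < ‖X N ω - b‖} := by
    intro N ω _
    by_contra h
    simp only [Set.mem_union, Set.mem_setOf_eq, not_or, not_lt] at h
    have h3 : ‖a - b‖ ≤ ‖X N ω - a‖ + ‖X N ω - b‖ := by
      calc ‖a - b‖ = ‖(X N ω - b) - (X N ω - a)‖ := by congr 1; abel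
        _ ≤ ‖X N ω - b‖ + ‖X N ω - a‖ := norm_sub_le _ _
        _ = ‖X N ω - a‖ + ‖X N ω - b‖ := add_comm _ _
    linarith [h.1, h.2, norm_nonneg (a - b)]
  have hge : ∀ N, (1 : ℝ≥0∞) ≤ P N {ω | ‖a - b‖ / 3 < ‖X N ω - a‖} + P N {ω | ‖a - b‖ / 3 < ‖X N ω - b‖} := by
    intro N
    calc (1 : ℝ≥0∞) = P N Set.univ := measure_univ.symm
      _ ≤ P N ({ω | ‖a - b‖ / 3 < ‖X N ω - a‖} ∪ {ω | ‖a - b‖ / 3 < ‖X N ω - b‖}) := measure_mono (hcover N)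
      _ ≤ _ := measure_union_le _ _
  have hlim := (ha _ hd).add (hb _ hd)
  rw [add_zero] at hlim
  have h10 : (1 : ℝ≥0∞) ≤ 0 := ge_of_tendsto' hlim hge
  exact absurd h10 (by simp)

/-- Real-valued version (deviation events written with `|·|`). -/
theorem eq_of_tendsto_measure_lt_abs_sub {Ω : ℕ → Type*} [∀ N, MeasurableSpace (Ω N)]
    (P : ∀ N, Measure (Ω N)) [∀ N, IsProbabilityMeasure (P N)] (X : ∀ N, Ω N → ℝ) {a b : ℝ}
    (ha : ∀ δ : ℝ, 0 < δ → Tendsto (fun N => P N {ω | δ < |X N ω - a|}) atTop (𝓝 0))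
    (hb : ∀ δ : ℝ, 0 < δ → Tendsto (fun N => P N {ω | δ < |X N ω - b|}) atTop (𝓝 0)) : a = b :=
  eq_of_tendsto_measure_lt_norm_sub P X (fun δ hδ => by simpa only [Real.norm_eq_abs] using ha δ hδ)
    (fun δ hδ => by simpa only [Real.norm_eq_abs] using hb δ hδ)

/-- `ofReal (K e^{-(N+1)/K}) → 0`. -/
theorem tendsto_ofReal_Kexp {K : ℝ} (hK : 0 < K) :
    Tendsto (fun N : ℕ => ENNReal.ofReal (K * Real.exp (-(K⁻¹ * ((N : ℝ) + 1))))) atTop (𝓝 0) := by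
  have h1 : Tendsto (fun N : ℕ => K⁻¹ * ((N : ℝ) + 1)) atTop atTop :=
    (tendsto_natCast_atTop_atTop.atTop_add tendsto_const_nhds).const_mul_atTop (inv_pos.2 hK)
  have h2 : Tendsto (fun N : ℕ => Real.exp (-(K⁻¹ * ((N : ℝ) + 1)))) atTop (𝓝 0) :=
    Real.tendsto_exp_atBot.comp (tendsto_neg_atTop_atBot.comp h1)
  have h3 := h2.const_mul K
  rw [mul_zero] at h3
  have h4 := ENNReal.tendsto_ofReal h3
  rwa [ENNReal.ofReal_zero] at h4

/-! ### Continuous functions are determined by their integrals against continuous weights -/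

/-- Two continuous real functions on `𝕋³` with the same integrals against every continuous weight
are equal. -/
theorem eq_of_forall_integral_mul_eq {f g : T3 → ℝ} (hf : Continuous f) (hg : Continuous g)
    (h : ∀ χ : T3 → ℝ, Continuous χ → ∫ x, χ x * f x = ∫ x, χ x * g x) : f = g := by
  have hχ := h (fun x => f x - g x) (hf.sub hg)
  have hi1 : Integrable (fun x => (f x - g x) * f x) := integrable_of_continuous_T3 ((hf.sub hg).mul hf)
  have hi2 : Integrable (fun x => (f x - g x) * g x) := integrable_of_continuous_T3 ((hf.sub hg).mul hg)
  have hint : ∫ x, (f x - g x) ^ 2 = 0 := by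
    have h1 : (∫ x, (f x - g x) * f x) - ∫ x, (f x - g x) * g x = 0 := sub_eq_zero.2 hχ
    rw [← integral_sub hi1 hi2] at h1
    rw [← h1]
    exact integral_congr_ae (ae_of_all _ fun x => by ring)
  have hcont : Continuous fun x => (f x - g x) ^ 2 := (hf.sub hg).pow 2
  have hae : (fun x => (f x - g x) ^ 2) =ᵐ[volume] (fun _ => (0 : ℝ)) :=
    (integral_eq_zero_iff_of_nonneg (fun x => sq_nonneg _) (integrable_of_continuous_T3 hcont)).1 hint
  have heq : (fun x => (f x - g x) ^ 2) = fun _ => (0 : ℝ) :=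
    (Continuous.ae_eq_iff_eq volume hcont continuous_const).1 hae
  funext x
  have hx : (f x - g x) ^ 2 = 0 := congrFun heq x
  exact sub_eq_zero.1 (pow_eq_zero_iff two_ne_zero |>.1 hx)

/-- Vector version: `f • v = g • w` if `∫ (χ f) • v = ∫ (χ g) • w` for every continuous `χ`. -/
theorem eq_of_forall_integral_smul_eq {f g : T3 → ℝ} {v w : T3 → V3} (hf : Continuous f)
    (hg : Continuous g) (hv : Continuous v) (hw : Continuous w)
    (h : ∀ χ : T3 → ℝ, Continuous χ → ∫ x, (χ x * f x) • v x = ∫ x, (χ x * g x) • w x) :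
    (fun x => f x • v x) = fun x => g x • w x := by
  have hcoord : ∀ l : Fin 3, (fun x => f x * v x l) = fun x => g x * w x l := by
    intro l
    have hvl : Continuous fun x => v x l := (EuclideanSpace.proj l : V3 →L[ℝ] ℝ).continuous.comp hv
    have hwl : Continuous fun x => w x l := (EuclideanSpace.proj l : V3 →L[ℝ] ℝ).continuous.comp hw
    refine eq_of_forall_integral_mul_eq (hf.mul hvl) (hg.mul hwl) fun χ hχ => ?_
    have key : ∀ {f' : T3 → ℝ} {v' : T3 → V3}, Continuous f' → Continuous v' →
        (∫ x, (χ x * f' x) • v' x) l = ∫ x, χ x * (f' x * v' x l) := by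
      intro f' v' hf' hv'
      have hint : Integrable (fun x => (χ x * f' x) • v' x) := integrable_of_continuous_T3 ((hχ.mul hf').smul hv')
      rw [show (∫ x, (χ x * f' x) • v' x) l = (EuclideanSpace.proj l : V3 →L[ℝ] ℝ) (∫ x, (χ x * f' x) • v' x) from rfl,
        ← ContinuousLinearMap.integral_comp_comm _ hint]
      refine integral_congr_ae (ae_of_all _ fun x => ?_)
      simp only [EuclideanSpace.coe_proj, PiLp.smul_apply, smul_eq_mul]
      ring
    rw [← key hf hv, ← key hg hw, h χ hχ]
  funext x
  ext l
  have := congrFun (hcoord l) x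
  simpa only [PiLp.smul_apply, smul_eq_mul] using this

/-! ### The flow at time `0` -/

/-- Under the local Gibbs law, composing with `Φ_0` changes nothing (`Φ_0 = id` on the good set,
which is conull for the absolutely continuous law). -/
theorem lintegral_comp_flow_zero {a₀ θ₀ : T3 → ℝ} {u₀ : T3 → V3} (σ : ℝ) (N : ℕ)
    (Φ : HardSphereFlow (Literature.Analysis.FluidPDE.Torus.geometry (Fin 3)) (hsDiameter σ N) (N + 1))
    (G : Config (N + 1) (Fin 3) T3 → ℝ≥0∞) :
    ∫⁻ z, G (Φ.flow 0 z) ∂localGibbsLaw σ a₀ u₀ θ₀ N Φ = ∫⁻ z, G z ∂localGibbsMeasure σ a₀ u₀ θ₀ N := by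
  rw [localGibbsLaw_eq]
  refine lintegral_congr_ae ?_
  have hgood : ∀ᵐ z ∂localGibbsMeasure σ a₀ u₀ θ₀ N, z ∈ Φ.good :=
    (localGibbsMeasure_absolutelyContinuous σ a₀ u₀ θ₀ N Φ).ae_le Φ.ae_mem_good
  filter_upwards [hgood] with z hz
  rw [Φ.flow_zero z hz]

/-! ### The theorem -/

/-- **`LocalGibbsFineScale` for positive existence times** (item stmt-AtomisticToContinuum-9905 with
`0 < T`; see the module docstring). -/
theorem localGibbsFineScale_of_pos :
    ∀ (a₀ θ₀ : Literature.MathematicalPhysics.KineticTheory.T3 → ℝ) (u₀ : Literature.MathematicalPhysics.KineticTheory.T3 → Literature.MathematicalPhysics.KineticTheory.V3), Continuous a₀ → Continuous θ₀ → Continuous u₀ → (∀ x, 0 < a₀ x) → (∀ x, 0 < θ₀ x) → ∃ σ₀ : ℝ, 0 < σ₀ ∧ ∀ σ : ℝ, 0 < σ → σ < σ₀ → ∀ (T : ℝ) (ρ θ : ℝ → Literature.MathematicalPhysics.KineticTheory.T3 → ℝ) (u : ℝ → Literature.MathematicalPhysics.KineticTheory.T3 → Literature.MathematicalPhysics.KineticTheory.V3),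 Literature.MathematicalPhysics.KineticTheory.IsHardSphereEulerSolution σ T ρ u θ → 0 < T → ∀ Φ : (N : ℕ) → Literature.Analysis.FluidPDE.HardSphereFlow (Literature.Analysis.FluidPDE.Torus.geometry (Fin 3)) (Literature.MathematicalPhysics.KineticTheory.hsDiameter σ N) (N + 1), Literature.MathematicalPhysics.KineticTheory.TendstoHydroFieldsAt (fun N => Literature.MathematicalPhysics.KineticTheory.localGibbsLaw σ a₀ u₀ θ₀ N (Φ N)) Φ ρ u θ 0 → ∀ ℓ : ℕ → ℝ, (∀ N, 0 < ℓ N ∧ ℓ N ≤ 1) → Tendsto ℓ atTop (𝓝 0) → Tendsto (fun N : ℕ => ℓ N ^ 3 * ((N : ℝ) + 1)) atTop atTop → let K := fun (l : ℝ) (x y : Literature.MathematicalPhysics.KineticTheory.T3) => indicator {y' : Literature.MathematicalPhysics.KineticTheory.T3 | ∀ i, ‖y' i - x i‖ < l / 2} (fun _ => (l ^ 3)⁻¹) y; let Dn := fun N t z x => Literature.MathematicalPhysics.KineticTheory.empiricalDensityField ((Φ N).flow t z) (K (ℓ N) x); let Mm := fun N t z x => Literature.MathematicalPhysics.KineticTheory.empiricalMomentumField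 ((Φ N).flow t z) (K (ℓ N) x); let En := fun N t z x => Literature.MathematicalPhysics.KineticTheory.empiricalEnergyField ((Φ N).flow t z) (K (ℓ N) x); Tendsto (fun N : ℕ => ∫⁻ z, ENNReal.ofReal (∫ x, (|Dn N 0 z x - ρ 0 x| + ‖Mm N 0 z x - ρ 0 x • u 0 x‖ + |En N 0 z x - Literature.MathematicalPhysics.KineticTheory.totalEnergyDensity (ρ 0 x) (u 0 x) (θ 0 x)|)) ∂(Literature.MathematicalPhysics.KineticTheory.localGibbsLaw σ a₀ u₀ θ₀ N (Φ N))) atTop (𝓝 0) := by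
  intro a₀ θ₀ u₀ ha hθ hu ha0 hθ0
  set P := profileOf a₀ ha ha0 with hP
  have hM := P.M_pos
  have hv := v₁_pos
  refine ⟨min (1 / 4) (1 / (64 * Real.exp 1 * P.M * v₁)), lt_min (by norm_num) (by positivity), ?_⟩
  intro σ hσ hσlt T ρ θ u hEul hT Φ hL ℓ hℓ hℓ0 hℓ3
  have hσ4 : σ < 1 / 4 := hσlt.trans_le (min_le_left _ _)
  have hσ2 : σ < 1 / 2 := by linarith
  have hσM : σ < 1 / (64 * Real.exp 1 * P.M * v₁) := hσlt.trans_le (min_le_right _ _)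
  have hsmall : Real.exp 1 * (2 * P.M * v₁ * σ ^ 3) ≤ 1 / 32 := by
    have hden : 0 < 64 * Real.exp 1 * P.M * v₁ := by positivity
    rw [lt_div_iff₀ hden] at hσM
    have h3 : σ ^ 3 ≤ σ := by
      have : σ ^ 2 ≤ 1 := by nlinarith
      nlinarith
    nlinarith [mul_le_mul_of_nonneg_left h3 (by positivity : (0 : ℝ) ≤ Real.exp 1 * (2 * P.M * v₁))]
  have hs : SmallDensity P σ := UniformLGC.smallDensity_of_eta_le (Mstar := 2 * P.M) hσ hσ2 (by linarith) hsmall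
  -- continuity of the time-`0` slices (`0 < T`)
  have h0T : (0 : ℝ) ∈ Set.Ico 0 T := ⟨le_rfl, hT⟩
  have hρc : Continuous (ρ 0) := (hEul.smooth_density.isSmooth_slice h0T).continuous
  have huc : Continuous (u 0) := (hEul.smooth_velocity.isSmooth_slice h0T).continuous
  have hθc : Continuous (θ 0) := (hEul.smooth_temperature.isSmooth_slice h0T).continuous
  set ρ₀ := rhoLim P σ with hρ₀
  have hρ₀c : Continuous ρ₀ := hs.continuous_rhoLim
  haveI hprob : ∀ N, IsProbabilityMeasure (localGibbsMeasure σ a₀ u₀ θ₀ N) := fun N =>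
    isProbabilityMeasure_localGibbsMeasure ha hθ hu ha0 hθ0 hσ2.le N
  -- identification of the density
  have hidρ : ρ 0 = ρ₀ := by
    refine eq_of_forall_integral_mul_eq hρc hρ₀c fun χ hχ => ?_
    refine eq_of_tendsto_measure_lt_abs_sub (fun N => localGibbsMeasure σ a₀ u₀ θ₀ N)
      (fun N z => empiricalDensityField z χ) (fun δ hδ => ?_) (fun δ hδ => ?_)
    · refine ((hL χ hχ δ hδ).1).congr fun N => ?_
      exact localGibbsLaw_preimage_flow_zero σ a₀ u₀ θ₀ N (Φ N)
        {w | δ < |empiricalDensityField w χ - ∫ x, χ x * ρ 0 x|}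
    · obtain ⟨K, hK, hb⟩ := UniformLGC.localGibbsMeasure_density_le (u₀ := u₀) ha hθ hu ha0 hθ0 hσ hσ2 hsmall hχ hδ
      refine tendsto_of_tendsto_of_tendsto_of_le_of_le tendsto_const_nhds (tendsto_ofReal_Kexp hK)
        (fun N => zero_le) (fun N => le_trans (le_of_eq ?_) (hb N))
      congr 1
      ext z
      simp only [Set.mem_setOf_eq, empiricalDensityField_eq_sum, hρ₀, hP]
  -- identification of the momentum
  have hidm : (fun x => ρ 0 x • u 0 x) = fun x => ρ₀ x • u₀ x := by
    refine eq_of_forall_integral_smul_eq hρc hρ₀c huc hu fun χ hχ => ?_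
    refine eq_of_tendsto_measure_lt_norm_sub (fun N => localGibbsMeasure σ a₀ u₀ θ₀ N)
      (fun N z => empiricalMomentumField z χ) (fun δ hδ => ?_) (fun δ hδ => ?_)
    · refine ((hL χ hχ δ hδ).2.1).congr fun N => ?_
      exact localGibbsLaw_preimage_flow_zero σ a₀ u₀ θ₀ N (Φ N)
        {w | δ < ‖empiricalMomentumField w χ - ∫ x, (χ x * ρ 0 x) • u 0 x‖}
    · obtain ⟨K, hK, hb⟩ := UniformLGC.localGibbsMeasure_momentum_le ha hθ hu ha0 hθ0 hσ hσ2 hsmall hχ hδ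
      exact tendsto_of_tendsto_of_tendsto_of_le_of_le tendsto_const_nhds (tendsto_ofReal_Kexp hK)
        (fun N => zero_le) (fun N => hb N)
  -- identification of the energy
  have hidE : (fun x => totalEnergyDensity (ρ 0 x) (u 0 x) (θ 0 x)) =
      fun x => totalEnergyDensity (ρ₀ x) (u₀ x) (θ₀ x) := by
    have hc1 : Continuous fun x => totalEnergyDensity (ρ 0 x) (u 0 x) (θ 0 x) := by
      unfold totalEnergyDensity; fun_prop
    have hc2 : Continuous fun x => totalEnergyDensity (ρ₀ x) (u₀ x) (θ₀ x) := by
      unfold totalEnergyDensity; fun_prop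
    refine eq_of_forall_integral_mul_eq hc1 hc2 fun χ hχ => ?_
    refine eq_of_tendsto_measure_lt_abs_sub (fun N => localGibbsMeasure σ a₀ u₀ θ₀ N)
      (fun N z => empiricalEnergyField z χ) (fun δ hδ => ?_) (fun δ hδ => ?_)
    · refine ((hL χ hχ δ hδ).2.2).congr fun N => ?_
      exact localGibbsLaw_preimage_flow_zero σ a₀ u₀ θ₀ N (Φ N)
        {w | δ < |empiricalEnergyField w χ - ∫ x, χ x * totalEnergyDensity (ρ 0 x) (u 0 x) (θ 0 x)|}
    · obtain ⟨K, hK, hb⟩ := UniformLGC.localGibbsMeasure_energy_le ha hθ hu ha0 hθ0 hσ hσ2 hsmall hχ hδ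
      exact tendsto_of_tendsto_of_tendsto_of_le_of_le tendsto_const_nhds (tendsto_ofReal_Kexp hK)
        (fun N => zero_le) (fun N => hb N)
  -- the statics at the box kernel
  have hr : Tendsto (fun N : ℕ => ℓ N / 2) atTop (𝓝 0) := by simpa using hℓ0.div_const 2
  have hwin : Tendsto (fun N : ℕ => (ℓ N ^ 3)⁻¹ / ((N : ℝ) + 1)) atTop (𝓝 0) := by
    refine (hℓ3.inv_tendsto_atTop).congr fun N => ?_
    rw [Pi.inv_apply, mul_inv, div_eq_mul_inv]
  have key := statics_kernel ha hθ hu ha0 hθ0 hσ2.le hs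
    (g := fun N x y => Set.indicator {y' : T3 | ∀ i, ‖y' i - x i‖ < ℓ N / 2} (fun _ => (ℓ N ^ 3)⁻¹) y)
    (Cg := fun N => (ℓ N ^ 3)⁻¹) (r := fun N => ℓ N / 2)
    (fun N => measurable_boxK_uncurry (ℓ N)) (fun N x y => boxK_nonneg (hℓ N).1.le x y)
    (fun N x y => boxK_le (hℓ N).1.le x y) (fun N x => integral_boxK_right (hℓ N).1 (hℓ N).2 x)
    (fun N x y h => dist_lt_of_boxK_ne_zero (hℓ N).1 h) hr hwin
  -- rewriting the goal into the statics
  intro K Dn Mm En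
  have hidρ' : ∀ x, ρ 0 x = ρ₀ x := fun x => congrFun hidρ x
  have hidm' : ∀ x, ρ 0 x • u 0 x = ρ₀ x • u₀ x := fun x => congrFun hidm x
  have hidE' : ∀ x, totalEnergyDensity (ρ 0 x) (u 0 x) (θ 0 x) = totalEnergyDensity (ρ₀ x) (u₀ x) (θ₀ x) :=
    fun x => congrFun hidE x
  simp only [K, Dn, Mm, En]
  simp_rw [hidm', hidE', hidρ']
  refine key.congr fun N => ?_
  exact (lintegral_comp_flow_zero σ N (Φ N) _).symm

end LGFS
end Summit.AtomisticToContinuum.HydrodynamicLimit.Theorems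
end
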